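import Literature.Analysis.InnerProduct.RankOneInertia

/-!
# The negative direction of a rank-one downdate of a nonnegative symmetric operator
# (single-driver law, secular criterion, resolvent shadow, graded orthogonality)

Topic `Literature/Analysis/InnerProduct` (companion of `RankOneInertia`, `RankOneInterlacing`,
`RankOneSecular`). Let `A` be a symmetric operator on a real inner product space whose form is
nonnegative, `v` a vector, and consider the DOWNDATED form `x ↦ ⟪A x, x⟫ − ⟪v, x⟫²`, i.e. the
operator `Q = A − |v⟩⟨v|`. Everything below is the elementary linear algebra of
Golub–Van Loan, *Matrix Computations* (4th ed.), Theorem 8.1.8 (eigenvalues of `A + τ c cᵀ`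
interlace those of `A`, so a rank-one change moves the inertia by at most one) and §8.4.3,
Theorem 8.4.3 (the secular equation `1 + ρ zᵀ(D − λ I)⁻¹ z = 0` and (c): the eigenvector of the
rank-one modification is a multiple of `(D − λ I)⁻¹ z`), Bunch–Nielsen–Sorensen, *Rank-one
modification of the symmetric eigenproblem*, Numer. Math. 31 (1978) 31–48, and Horn–Johnson,
*Matrix Analysis* (2nd ed.) Cor. 4.3.9 — recorded DIMENSION-FREE (no spectral theorem, no
finite-dimensionality; the resolvent vector `y`, `A y + ε y = v`, and the witness `z`, `A z = v`,
are hypotheses) in the one-line forms used downstream: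

* `rankOne_downdate_nonneg_on_pair` — SINGLE-DRIVER LAW: on every pair of directions the downdated
  form is nonnegative at some nontrivial combination; i.e. no two-dimensional subspace is negative
  definite for `A − |v⟩⟨v|` (negative index ≤ 1). [GVL Thm 8.1.8 / HJ Cor. 4.3.9, inertia form]
* `rankOne_downdate_indefinite_iff` — SECULAR CRITERION: with a witness `A z = v`,
  `(∃ x, ⟪A x, x⟫ < ⟪v, x⟫²) ↔ 1 < ⟪v, z⟫` (`= vᵀ A⁻¹ v`); Cauchy–Schwarz for the form of `A`.
* `rankOne_downdate_moment_ne_zero` — an eigenvector `u` of the downdate with eigenvalue `−ε < 0`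
  (`A u − ⟪v, u⟫ v = −ε u`) has `⟪v, u⟫ ≠ 0`. [GVL Lemma 8.4.2 analogue]
* `rankOne_downdate_eigenvector_eq_smul` — RESOLVENT SHADOW: if moreover `A y + ε y = v` then
  `u = ⟪v, u⟫ • y`, i.e. the negative eigenvector is a multiple of `(A + ε)⁻¹ v`. [GVL Thm 8.4.3 (c)]
* `rankOne_downdate_secular_eq_one` — the secular equation at the negative eigenvalue:
  `⟪v, y⟫ = 1` (`vᵀ (A + ε)⁻¹ v = 1`). [GVL Thm 8.4.3 (a)]
* `sq_inner_le_resolvent` — GRADED ORTHOGONALITY in the basis of `A`: for every `φ`,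
  `⟪φ, v⟫² ≤ (⟪A φ, φ⟫ + ε ⟪φ, φ⟫) · ⟪v, y⟫`; for a unit eigenvector `A φ = α φ` at the negative
  eigenvalue this is `⟪φ, v⟫² ≤ α + ε` (`sq_inner_le_eigenvalue_add`): the driver `v` is almost
  orthogonal to every eigenvector of `A` far below the scale `ε`.
* `graded_orthogonality_of_rankOne_psd` — the same phenomenon in the basis of the downdate `T`
  (`T u₁ = −e₁ u₁`, `T u₂ = e₂ u₂`, orthonormal) when `T + |v⟩⟨v| ≥ 0`:
  `e₁ ⟪v, u₂⟫² + e₁ e₂ ≤ e₂ ⟪v, u₁⟫²` (the 2 × 2 compression must be nonnegative).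

Motivation (pub-rhpf cell THEORY-3, "the intruder is the resolvent-filtered shadow of an off-line
zero"; mechanism/rigidity campaign, no RH claims): by the explicit formula the windowed Weil form
of a family with an off-line zero quadruple `½ ± δ ± iγ` is `A − 4|d⟩⟨d|` with `A` the form of the
remaining zeros and `d = Im ∫ ξ e^{(δ+iγ)x}`; these lemmas say that as long as `A ≥ 0` there is at
most ONE negative direction, that it appears exactly when `4 dᵀ A⁻¹ d` crosses `1`, that it is the
vector `(A + |ε₁|)⁻¹ d`, and that `d` is nearly orthogonal to the low rungs of `A`. Abstract linear
algebra only; no definitions, no named facts; sorry-free.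

## References
* G. H. Golub, C. F. Van Loan, *Matrix Computations*, 4th ed., Johns Hopkins (2013), Thm 8.1.8,
  §8.4.3 Lemma 8.4.2 and Thm 8.4.3. [GolubVanLoan2013]
* J. R. Bunch, C. P. Nielsen, D. C. Sorensen, Rank-one modification of the symmetric eigenproblem,
  Numer. Math. 31 (1978) 31–48, doi:10.1007/BF01396012. [BunchNielsenSorensen1978]
* R. A. Horn, C. R. Johnson, *Matrix Analysis*, 2nd ed., CUP (2013), Cor. 4.3.9. [HornJohnson2013]
-/

noncomputable section

open scoped InnerProductSpace RealInnerProductSpace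

namespace Literature.Analysis.InnerProduct

variable {E : Type*} [NormedAddCommGroup E] [InnerProductSpace ℝ E]

/-- **Single-driver law** (inertia moves by at most one under a rank-one change): if the form of `A`
is nonnegative then for any two directions `x, y` some nontrivial combination `a x + b y` has
`⟪A (a x + b y), a x + b y⟫ − ⟪v, a x + b y⟫² ≥ 0`; no two-dimensional subspace is negative definite
for `A − |v⟩⟨v|`. [cite: GolubVanLoan2013, Thm 8.1.8; HornJohnson2013, Cor 4.3.9] -/
theorem rankOne_downdate_nonneg_on_pair (A : E →ₗ[ℝ] E) (hpos : ∀ x : E, 0 ≤ ⟪A x, x⟫_ℝ)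
    (v x y : E) : ∃ a b : ℝ, (a ≠ 0 ∨ b ≠ 0) ∧
      0 ≤ ⟪A (a • x + b • y), a • x + b • y⟫_ℝ - ⟪v, a • x + b • y⟫_ℝ ^ 2 := by
  by_cases h : ⟪v, x⟫_ℝ = 0
  · refine ⟨1, 0, Or.inl one_ne_zero, ?_⟩
    simpa [h] using hpos x
  · refine ⟨⟪v, y⟫_ℝ, -⟪v, x⟫_ℝ, Or.inr (neg_ne_zero.mpr h), ?_⟩
    have h0 : ⟪v, ⟪v, y⟫_ℝ • x + (-⟪v, x⟫_ℝ) • y⟫_ℝ = 0 := by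
      rw [inner_add_right, real_inner_smul_right, real_inner_smul_right]; ring
    rw [h0, sq, mul_zero, sub_zero]
    exact hpos _

/-- **Secular criterion** for the downdate to be indefinite: with a witness `A z = v` of
`z = A⁻¹ v`, the downdated form `⟪A x, x⟫ − ⟪v, x⟫²` takes a negative value iff `1 < ⟪v, z⟫`
(`vᵀ A⁻¹ v > 1`); "only if" is Cauchy–Schwarz for the nonnegative form of `A`, "if" is `x = z`.
[cite: GolubVanLoan2013, Thm 8.4.3 (a); BunchNielsenSorensen1978] -/
theorem rankOne_downdate_indefinite_iff (A : E →ₗ[ℝ] E)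
    (hsym : ∀ x y : E, ⟪A x, y⟫_ℝ = ⟪x, A y⟫_ℝ) (hpos : ∀ x : E, 0 ≤ ⟪A x, x⟫_ℝ)
    {v z : E} (hz : A z = v) :
    (∃ x : E, ⟪A x, x⟫_ℝ < ⟪v, x⟫_ℝ ^ 2) ↔ 1 < ⟪v, z⟫_ℝ := by
  constructor
  · rintro ⟨x, hx⟩
    have hcs := sq_inner_le_of_nonneg_form A hsym ⊤ (fun y _ => hpos y)
      (Submodule.mem_top : z ∈ ⊤) (Submodule.mem_top : x ∈ ⊤)
    rw [hz] at hcs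
    by_contra hle
    have hle' : ⟪v, z⟫_ℝ ≤ 1 := not_lt.mp hle
    nlinarith [hpos x, hcs, hx, hle', sq_nonneg ⟪v, x⟫_ℝ]
  · intro h
    refine ⟨z, ?_⟩
    have hzz : ⟪A z, z⟫_ℝ = ⟪v, z⟫_ℝ := by rw [hz]
    rw [hzz]
    nlinarith

/-- The "polar moment" of a negative eigenvector of the downdate is nonzero: if `A ≥ 0`, `ε > 0`,
`u ≠ 0` and `A u − ⟪v, u⟫ v = −ε u`, then `⟪v, u⟫ ≠ 0` (else `⟪A u, u⟫ = −ε ‖u‖² < 0`).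
[cite: GolubVanLoan2013, Lemma 8.4.2] -/
theorem rankOne_downdate_moment_ne_zero (A : E →ₗ[ℝ] E) (hpos : ∀ x : E, 0 ≤ ⟪A x, x⟫_ℝ)
    {u v : E} {ε : ℝ} (hε : 0 < ε) (hu0 : u ≠ 0)
    (hu : A u - ⟪v, u⟫_ℝ • v = -(ε • u)) : ⟪v, u⟫_ℝ ≠ 0 := by
  intro h0
  rw [h0, zero_smul, sub_zero] at hu
  have h1 := hpos u
  rw [hu, inner_neg_left, real_inner_smul_left] at h1
  have h2 : ⟪u, u⟫_ℝ ≤ 0 := by nlinarith [real_inner_self_nonneg (x := u)]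
  exact hu0 (real_inner_self_nonpos.mp h2)

/-- **Resolvent shadow**: a negative eigenvector of the downdate, `A u − ⟪v, u⟫ v = −ε u` with
`ε > 0` and `A ≥ 0`, is a multiple of the resolvent vector `y = (A + ε)⁻¹ v` (`A y + ε y = v`):
`u = ⟪v, u⟫ • y`. [cite: GolubVanLoan2013, Thm 8.4.3 (c)] -/
theorem rankOne_downdate_eigenvector_eq_smul (A : E →ₗ[ℝ] E) (hpos : ∀ x : E, 0 ≤ ⟪A x, x⟫_ℝ)
    {u v y : E} {ε : ℝ} (hε : 0 < ε)
    (hu : A u - ⟪v, u⟫_ℝ • v = -(ε • u)) (hy : A y + ε • y = v) :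
    u = ⟪v, u⟫_ℝ • y := by
  set c := ⟪v, u⟫_ℝ with hc
  set w := u - c • y with hw
  have hAu : A u = -(ε • u) + c • v := (sub_eq_iff_eq_add).mp hu
  have hAy : A y = v - ε • y := eq_sub_of_add_eq hy
  have hAw : A w = -(ε • w) := by
    rw [hw, map_sub, map_smul, hAu, hAy]
    module
  have h1 := hpos w
  rw [hAw, inner_neg_left, real_inner_smul_left] at h1
  have h2 : ⟪w, w⟫_ℝ ≤ 0 := by nlinarith [real_inner_self_nonneg (x := w)]
  have hw0 : w = 0 := real_inner_self_nonpos.mp h2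
  exact sub_eq_zero.mp hw0

/-- **Secular equation at the negative eigenvalue**: in the situation of
`rankOne_downdate_eigenvector_eq_smul` with `u ≠ 0`, `⟪v, y⟫ = 1`, i.e. `vᵀ (A + ε)⁻¹ v = 1`.
[cite: GolubVanLoan2013, Thm 8.4.3 (a)] -/
theorem rankOne_downdate_secular_eq_one (A : E →ₗ[ℝ] E) (hpos : ∀ x : E, 0 ≤ ⟪A x, x⟫_ℝ)
    {u v y : E} {ε : ℝ} (hε : 0 < ε) (hu0 : u ≠ 0)
    (hu : A u - ⟪v, u⟫_ℝ • v = -(ε • u)) (hy : A y + ε • y = v) :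
    ⟪v, y⟫_ℝ = 1 := by
  have hc := rankOne_downdate_moment_ne_zero A hpos hε hu0 hu
  have huy := rankOne_downdate_eigenvector_eq_smul A hpos hε hu hy
  have h : ⟪v, u⟫_ℝ = ⟪v, u⟫_ℝ * ⟪v, y⟫_ℝ := by
    conv_lhs => rw [huy]
    rw [real_inner_smul_right]
  have h' : ⟪v, u⟫_ℝ * 1 = ⟪v, u⟫_ℝ * ⟪v, y⟫_ℝ := by rw [mul_one]; exact h
  exact (mul_left_cancel₀ hc h').symm

/-- **Graded orthogonality in the basis of `A`** (Cauchy–Schwarz for the nonnegative form of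
`A + ε`): if `A ≥ 0`, `ε ≥ 0` and `A y + ε y = v`, then for every `φ`,
`⟪φ, v⟫² ≤ (⟪A φ, φ⟫ + ε ⟪φ, φ⟫) · ⟪v, y⟫`. [folklore] -/
theorem sq_inner_le_resolvent (A : E →ₗ[ℝ] E)
    (hsym : ∀ x y : E, ⟪A x, y⟫_ℝ = ⟪x, A y⟫_ℝ) (hpos : ∀ x : E, 0 ≤ ⟪A x, x⟫_ℝ)
    {v y : E} {ε : ℝ} (hε : 0 ≤ ε) (hy : A y + ε • y = v) (φ : E) :
    ⟪φ, v⟫_ℝ ^ 2 ≤ (⟪A φ, φ⟫_ℝ + ε * ⟪φ, φ⟫_ℝ) * ⟪v, y⟫_ℝ := by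
  set T : E →ₗ[ℝ] E := A + ε • LinearMap.id with hT
  have hTapp : ∀ x : E, T x = A x + ε • x := by intro x; simp [hT]
  have hTsym : ∀ x y : E, ⟪T x, y⟫_ℝ = ⟪x, T y⟫_ℝ := by
    intro x y
    rw [hTapp, hTapp, inner_add_left, inner_add_right, real_inner_smul_left,
      real_inner_smul_right, hsym]
  have hTpos : ∀ x ∈ (⊤ : Submodule ℝ E), 0 ≤ ⟪T x, x⟫_ℝ := by
    intro x _
    rw [hTapp, inner_add_left, real_inner_smul_left]
    nlinarith [hpos x, real_inner_self_nonneg (x := x)]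
  have hTy : T y = v := by rw [hTapp]; exact hy
  have hcs := sq_inner_le_of_nonneg_form T hTsym ⊤ hTpos
    (Submodule.mem_top : φ ∈ ⊤) (Submodule.mem_top : y ∈ ⊤)
  rw [hTsym φ y, hTy] at hcs
  have hTφ : ⟪T φ, φ⟫_ℝ = ⟪A φ, φ⟫_ℝ + ε * ⟪φ, φ⟫_ℝ := by
    rw [hTapp, inner_add_left, real_inner_smul_left]
  rw [hTφ] at hcs
  exact hcs

/-- Graded orthogonality for a unit eigenvector `A φ = α φ` when the secular equation
`⟪v, y⟫ = 1` holds (`rankOne_downdate_secular_eq_one`): `⟪φ, v⟫² ≤ α + ε` — the driver `v` is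
nearly orthogonal to every eigenvector of `A` whose eigenvalue is far below `ε`. [folklore] -/
theorem sq_inner_le_eigenvalue_add (A : E →ₗ[ℝ] E)
    (hsym : ∀ x y : E, ⟪A x, y⟫_ℝ = ⟪x, A y⟫_ℝ) (hpos : ∀ x : E, 0 ≤ ⟪A x, x⟫_ℝ)
    {v y φ : E} {ε α : ℝ} (hε : 0 ≤ ε) (hy : A y + ε • y = v) (hvy : ⟪v, y⟫_ℝ = 1)
    (hφ : A φ = α • φ) (hφ1 : ‖φ‖ = 1) :
    ⟪φ, v⟫_ℝ ^ 2 ≤ α + ε := by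
  have h := sq_inner_le_resolvent A hsym hpos hε hy φ
  have hφφ : ⟪φ, φ⟫_ℝ = 1 := by rw [real_inner_self_eq_norm_sq, hφ1]; norm_num
  rw [hφ, real_inner_smul_left, hφφ, hvy] at h
  linarith

/-- **Graded orthogonality in the basis of the downdate.** Let `T` be symmetric with orthonormal
eigenvectors `T u₁ = −e₁ u₁`, `T u₂ = e₂ u₂` (`e₂ ≥ 0`), and suppose the rank-one UPDATE
`T + |v⟩⟨v|` is form-nonnegative. Then `e₁ ⟪v, u₂⟫² + e₁ e₂ ≤ e₂ ⟪v, u₁⟫²`: when `e₁ > 0` the update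
vector has `⟪v, u₂⟫² ≤ (e₂/e₁) ⟪v, u₁⟫² − e₂`, tiny on eigenvectors with `e₂ ≪ e₁` (test vector
`(⟪v,u₂⟫² + e₂) u₁ − ⟪v,u₁⟫⟪v,u₂⟫ u₂`, the `2 × 2` compression). [folklore: the `2 × 2` compression of a nonnegative form to
`span{u₁, u₂}` has nonnegative determinant] -/
theorem graded_orthogonality_of_rankOne_psd (T : E →ₗ[ℝ] E)
    {u₁ u₂ v : E} {e₁ e₂ : ℝ} (h1 : ‖u₁‖ = 1) (h2 : ‖u₂‖ = 1) (h12 : ⟪u₁, u₂⟫_ℝ = 0)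
    (hT1 : T u₁ = (-e₁) • u₁) (hT2 : T u₂ = e₂ • u₂) (he₂ : 0 ≤ e₂)
    (hpsd : ∀ x : E, 0 ≤ ⟪T x, x⟫_ℝ + ⟪v, x⟫_ℝ ^ 2) :
    e₁ * ⟪v, u₂⟫_ℝ ^ 2 + e₁ * e₂ ≤ e₂ * ⟪v, u₁⟫_ℝ ^ 2 := by
  set p := ⟪v, u₁⟫_ℝ with hp
  set q := ⟪v, u₂⟫_ℝ with hq
  have h11 : ⟪u₁, u₁⟫_ℝ = 1 := by rw [real_inner_self_eq_norm_sq, h1]; norm_num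
  have h22 : ⟪u₂, u₂⟫_ℝ = 1 := by rw [real_inner_self_eq_norm_sq, h2]; norm_num
  have h21 : ⟪u₂, u₁⟫_ℝ = 0 := by rw [real_inner_comm]; exact h12
  have h := hpsd ((q ^ 2 + e₂) • u₁ + (-(p * q)) • u₂)
  have hTx : ⟪T ((q ^ 2 + e₂) • u₁ + (-(p * q)) • u₂), (q ^ 2 + e₂) • u₁ + (-(p * q)) • u₂⟫_ℝ
      = -e₁ * (q ^ 2 + e₂) ^ 2 + e₂ * (p * q) ^ 2 := by
    rw [map_add, map_smul, map_smul, hT1, hT2]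
    simp only [inner_add_left, inner_add_right, real_inner_smul_left, real_inner_smul_right,
      h11, h22, h12, h21]
    ring
  have hvx : ⟪v, (q ^ 2 + e₂) • u₁ + (-(p * q)) • u₂⟫_ℝ = p * e₂ := by
    rw [inner_add_right, real_inner_smul_right, real_inner_smul_right, ← hp, ← hq]
    ring
  rw [hTx, hvx] at h
  have key : -e₁ * (q ^ 2 + e₂) ^ 2 + e₂ * (p * q) ^ 2 + (p * e₂) ^ 2
      = (q ^ 2 + e₂) * (e₂ * p ^ 2 - e₁ * (q ^ 2 + e₂)) := by ring
  rw [key] at h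
  by_cases hz : q ^ 2 + e₂ = 0
  · have hq0 : q ^ 2 = 0 := by nlinarith [sq_nonneg q]
    have he0 : e₂ = 0 := by nlinarith [sq_nonneg q]
    rw [hq0, he0]
    nlinarith [sq_nonneg p]
  · have hpos' : 0 < q ^ 2 + e₂ := lt_of_le_of_ne (by positivity) (Ne.symm hz)
    have h3 : 0 ≤ e₂ * p ^ 2 - e₁ * (q ^ 2 + e₂) := by
      by_contra hneg
      have hneg' : e₂ * p ^ 2 - e₁ * (q ^ 2 + e₂) < 0 := not_le.mp hneg
      nlinarith [mul_neg_of_pos_of_neg hpos' hneg']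
    nlinarith [h3]

end Literature.Analysis.InnerProduct

end
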